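import Literature.RingTheory.CompleteIntersection.CongruenceModule
import Mathlib.RingTheory.MvPowerSeries.Basic
import Mathlib.RingTheory.Ideal.Cotangent
import Mathlib.RingTheory.Ideal.Over
import Mathlib.RingTheory.LocalRing.ResidueField.Basic
import Mathlib.RingTheory.LocalRing.RingHom.Basic
import Mathlib.RingTheory.LocalRing.Module
import Mathlib.RingTheory.Flat.Basic
import Mathlib.RingTheory.DiscreteValuationRing.Basic
import Mathlib.RingTheory.Artinian.Ring
import Mathlib.RingTheory.AdicCompletion.Basic
import Mathlib.RingTheory.Noetherian.Basic
import Mathlib.RingTheory.TensorProduct.Basic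
import Mathlib.LinearAlgebra.Matrix.Determinant.Basic
import Mathlib.LinearAlgebra.FreeModule.Basic
import Mathlib.Algebra.Module.Torsion.Basic
import HarnessLib

/-!
# Stub ideation `stub_liftThree`, ideator k = 2 (RESHAPE), generation 3 — typed companion

Crux `Summit.ABC.ABC.Theses.DefiniteXi.FreyModularity` (stmt-ABC-11340), skeleton
`Summits/ABC/ABC/Cruxes/FreyModularity/Lines/Sketch.lean`, stub

  `stub_liftThree : ∀ W [W.IsElliptic] (ρ : ModPGaloisRep ℚ (ZMod 3) 2), W.IsTorsionGaloisRep 3 ρ →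
     ρ.IsAbsIrreducibleOverSqrt (-3) → ¬ 9 ∣ W.conductorNorm ℤ → ρ.IsModular → W.IsModularGaloisRepTate 3`

(= minimal + level-raised `R = T` at `ℓ = 3`, Galois form). Generation 2 of this seat
(`STUB_IDEAS_stub_liftThree_2.lean`, namespace `…StubIdeas2`) typed the regime split
(`liftThree_of_regimes`), the dictionary H2–H7 and the de Smit–Rubin–Schoof Criterion-II engine
E2a–c for the MINIMAL case. This generation-3 file types the REPLACEMENT ENGINE E3 for the minimal
case: Brochard's proof of de Smit's conjecture (S. Brochard, *Proof of de Smit's conjecture: a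
freeness criterion*, Compositio Math. 153 (2017), arXiv:1607.02044, Thm. 1.1 and §3; second proof
via independent sequences, S. Brochard, arXiv:2204.07006 (2023), Prop. 11, Prop. 12, Thm. 18, Thm. 22;
Wiebe's criterion in the form of A.-M. Simon, J. Strooker, arXiv:math/0703880, Thm. 2.4 / Cor. 2.7),
which proves `R_∅ ≅ T_∅`, `T_∅` a complete intersection and `H_∅` free over `T_∅` from ONE
Taylor–Wiles level (`n = 1`, primes `q ≡ 1 (mod 3)`), with NO patching, NO Taylor–Wiles system, NO
numerical bound `p^m > n^{n-1} d^n`, and NO multiplicity-one / Gorenstein input (multiplicity one is an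
OUTPUT). Everything below is pure commutative algebra over Mathlib + the tree predicate
`IsCompleteIntersectionOver`; the number-theoretic inputs
(existence of the TW set `Q` — where the stub's `hirr` is consumed —, freeness of `H̄` over `k[Δ_Q]`,
and the identifications `R_Q/𝔞 = R_∅`, `T_Q/𝔞 = T_∅`) stay NAMED seats G1–G3 in the markdown card.

Helper statements are `theorem … := by sorry` (prover targets, each sized in its docstring);
definitions and the two assembled reductions marked "given …" are the only other content.
-/

set_option linter.dupNamespace false

namespace Summit.ABC.ABC.Cruxes.FreyModularity.StubIdeas2g3

open IsLocalRing
open scoped BigOperators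

universe u v

/-! ### E3.0  Vocabulary: embedding dimension, (strongly) `M`-independent sequences -/

/-- Embedding dimension `edim A = dim_{κ(A)} 𝔪_A/𝔪_A²` of a local ring. -/
noncomputable def edim (A : Type u) [CommRing A] [IsLocalRing A] : ℕ :=
  Module.finrank (ResidueField A) (CotangentSpace A)

/-- **Complete intersection over `O`** — VERBATIM MIRROR of the tree predicate
`IsCompleteIntersectionOver` (file
`Literature/RingTheory/CompleteIntersection/NumericalCriterion.lean`, de Smit–Rubin–Schoof p. 344:
`T ≅ O[[X₁, …, Xₙ]]/(f₁, …, fₙ)` as `O`-algebras, as many relations as variables). Mirrored here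
only because that module was unbuilt on the farm snapshot when this file was typed; a prover
replaces this `def` by the import (same body, so every statement below transports by `Iff.rfl`). -/
def IsCompleteIntersectionOver (O : Type u) (T : Type v) [CommRing O] [CommRing T]
    [Algebra O T] : Prop :=
  ∃ (n : ℕ) (f : Fin n → MvPowerSeries (Fin n) O),
    Nonempty ((MvPowerSeries (Fin n) O ⧸ Ideal.span (Set.range f)) ≃ₐ[O] T)

variable {B : Type u} [CommRing B]

/-- `J_x`, the ideal generated by a finite family `x`. -/
def spanOf {n : ℕ} (x : Fin n → B) : Ideal B := Ideal.span (Set.range x)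

/-- **`M`-independence in the sense of Lech–Hanes** (Brochard 2023, Def. 5; Brochard 2017, Def.
before Thm. 1.1 — "weakly torsion-free" iterated): every relation `∑ xᵢ mᵢ = 0` with `mᵢ ∈ M` has
all its coefficients in `J_x M`. -/
def IsIndependent {n : ℕ} (x : Fin n → B) (M : Type v) [AddCommGroup M] [Module B M] : Prop :=
  ∀ m : Fin n → M, ∑ i, x i • m i = 0 → ∀ i, m i ∈ spanOf x • (⊤ : Submodule B M)

/-- `y₁, …, y_l ∈ J` is PART OF A MINIMAL GENERATING SYSTEM of the ideal `J` of the local ring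
`B` (Nakayama form, choice-free): a `B`-linear combination of the `yⱼ` lying in `𝔪_B J` has all its
coefficients in `𝔪_B` (i.e. the images of the `yⱼ` in `J/𝔪_B J` are linearly independent). -/
def IsMinimalPartOf [IsLocalRing B] (J : Ideal B) {l : ℕ} (y : Fin l → B) : Prop :=
  (∀ j, y j ∈ J) ∧
    ∀ c : Fin l → B, (∑ j, c j * y j) ∈ maximalIdeal B * J → ∀ j, c j ∈ maximalIdeal B

/-- **Strong `M`-independence of an ideal** (Brochard 2023, Def. 7, in choice-free form): for
every `i ≥ 1` and every family `y` that is part of a minimal generating system of `Iⁱ`, every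
relation `∑ yⱼ mⱼ = 0` in `M` has its coefficients in `I M`. (For `i = 1` and `y` a full minimal
generating system this is `IsIndependent y M`.) -/
def IsStronglyIndependent [IsLocalRing B] (I : Ideal B) (M : Type v) [AddCommGroup M]
    [Module B M] : Prop :=
  ∀ i : ℕ, 1 ≤ i → ∀ (l : ℕ) (y : Fin l → B), IsMinimalPartOf (I ^ i) y →
    ∀ m : Fin l → M, ∑ j, y j • m j = 0 → ∀ j, m j ∈ I • (⊤ : Submodule B M)

/-! ### E3a  The freeness criterion (de Smit's conjecture), cut into prover-sized pieces -/

/-- **E3a1 — the transfer lemma** (Brochard 2017, Lemma 4 = Brochard 2023, Thm. 18 (3), first half;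
size M, pure matrix algebra: multiply the relation by the adjugate of `W`, `n` applications of
independence). If `x = W u` and `x` is `M`-independent, then `det(W) m ∈ J_x M ⇒ m ∈ J_u M`. -/
theorem brochard_transfer {n : ℕ} (x u : Fin n → B) (W : Matrix (Fin n) (Fin n) B)
    (hW : ∀ i, x i = ∑ j, W i j * u j)
    {M : Type v} [AddCommGroup M] [Module B M] (hx : IsIndependent x M)
    {m : M} (hm : W.det • m ∈ spanOf x • (⊤ : Submodule B M)) :
    m ∈ spanOf u • (⊤ : Submodule B M) := by
  sorry

/-- **E3a1′** (Brochard 2023, Thm. 18 (4), the part used; size S from E3a1 + Nakayama): with `x = W u`,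
`u ⊆ 𝔪_B`, `x` `M`-independent for a nonzero finite `B`-module `M`, the determinant `det W` is NOT
in `J_x` (else `M = J_u M`, so `M = 0`). -/
theorem det_notMem_spanOf [IsLocalRing B] {n : ℕ} (x u : Fin n → B) (W : Matrix (Fin n) (Fin n) B)
    (hW : ∀ i, x i = ∑ j, W i j * u j) (hu : ∀ j, u j ∈ maximalIdeal B)
    {M : Type v} [AddCommGroup M] [Module B M] [Module.Finite B M] [Nontrivial M]
    (hx : IsIndependent x M) : W.det ∉ spanOf x := by
  sorry

/-- **E3a2 — relations over a free module have small coefficients** (Brochard 2023, Prop. 11 (1);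
size S: expand in an `A`-basis of `M`; each coordinate of the relation is a `B`… an `A`-linear
combination `∑ aᵢ cᵢ = 0 ∈ 𝔪_A I`, so `cᵢ ∈ 𝔪_A` by minimality). -/
theorem coeff_mem_maximalIdeal_smul_of_free {A : Type u} [CommRing A] [IsLocalRing A]
    {M : Type v} [AddCommGroup M] [Module A M] [Module.Free A M]
    (I : Ideal A) {n : ℕ} (a : Fin n → A) (ha : IsMinimalPartOf I a)
    (m : Fin n → M) (h : ∑ i, a i • m i = 0) (i : Fin n) :
    m i ∈ (maximalIdeal A) • (⊤ : Submodule A M) := by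
  sorry

/-- **E3a2′ — hence the image of a minimal generating system of `𝔪_A` is `M`-independent in `B`**
(Brochard 2023, Prop. 11 (2) pushed along `A → B`; size S from E3a2: `𝔪_A M ⊆ (𝔪_A B) M`). -/
theorem isIndependent_algebraMap_of_free {A : Type u} [CommRing A] [IsLocalRing A] [Algebra A B]
    {M : Type v} [AddCommGroup M] [Module B M] [Module A M] [IsScalarTower A B M] [Module.Free A M]
    {n : ℕ} (a : Fin n → A) (ha : IsMinimalPartOf (maximalIdeal A) a)
    (hgen : Ideal.span (Set.range a) = maximalIdeal A) :
    IsIndependent (fun i => algebraMap A B (a i)) M := by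
  sorry

/-- **E3a2″ — and `𝔪_A B` is strongly `M`-independent in `B`** (the input of Brochard 2023,
Prop. 12 for `I = 𝔪_A B`; size M. Proof: for `y` part of a minimal generating system of
`(𝔪_A B)ⁱ = 𝔪_Aⁱ B`, write `y = c · a` with `a` a minimal generating system of `𝔪_Aⁱ` in `A`; a
relation `∑ yⱼ mⱼ = 0` gives `∑_t a_t (∑ⱼ c_{jt} mⱼ) = 0`, so `∑ⱼ c_{jt} mⱼ ∈ 𝔪_A M` by E3a2; the
matrix `c̄` over `κ(B)` has independent rows because `ȳ` is independent in `(𝔪_Aⁱ B)/𝔪_B(𝔪_Aⁱ B)`,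
so `c` has a right inverse modulo `𝔪_B`, hence over the local ring… over `B/𝔪_A B` acting on
`M/𝔪_A M`, giving `mⱼ ∈ 𝔪_A M`.) No flatness of `A → B` is used (contrast Brochard 2023, Cor. 3). -/
theorem isStronglyIndependent_map_maximalIdeal_of_free {A : Type u} [CommRing A] [IsLocalRing A]
    [IsNoetherianRing A] [IsLocalRing B] [IsNoetherianRing B] [Algebra A B]
    [IsLocalHom (algebraMap A B)]
    {M : Type v} [AddCommGroup M] [Module B M] [Module A M] [IsScalarTower A B M]
    [Module.Free A M] :
    IsStronglyIndependent ((maximalIdeal A).map (algebraMap A B)) M := by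
  sorry

/-- **E3a3 — freeness from strong independence** (Brochard 2023, Prop. 12 (2); size M: lift a basis of
`M/IM`; induction on `n` shows the lift is a basis of `M/IⁿM` over `B/Iⁿ` — the step uses a minimal
generating system of `Iⁿ` and strong independence —; conclude with Krull's intersection theorem,
Mathlib `Ideal.iInf_pow_smul_eq_bot_of_le_jacobson`, and Nakayama for generation). -/
theorem free_of_isStronglyIndependent [IsNoetherianRing B] [IsLocalRing B] (I : Ideal B)
    (hI : I ≤ maximalIdeal B) {M : Type v} [AddCommGroup M] [Module B M] [Module.Finite B M]
    (hfree : Module.Free (B ⧸ I) (M ⧸ (I • ⊤ : Submodule B M)))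
    (hind : IsStronglyIndependent I M) : Module.Free B M := by
  sorry

/-- **E3a4 — Wiebe's criterion, the core** (Wiebe 1969, Satz 1; Simon–Strooker, arXiv:math/0703880,
Prop. 2.1 "only if": in the regular local ring `S = k[[X₁, …, Xₙ]]`, if `a = φ·X` (`aᵢ = ∑ⱼ φᵢⱼ Xⱼ`) and
`det φ ∉ (a)`, then `a` is a system of parameters, i.e. `S/(a)` is Artinian; size M/L — their proof:
if `dim S/(a) > 0`, perturb `a` by terms of high order into a regular sequence `a' = φ'·X`
(prime avoidance on associated primes), use that `det φ'` lies in every ideal strictly above `(a')`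
(tree: `Literature.RingTheory.RegularLocalRing.mem_of_ofList_lt`, and over a field
`Literature.RingTheory.CompleteIntersection.TateGorensteinField`), get `det φ ∈ (a) + 𝔪ᵗ` for all `t`,
Krull). This is the ONE ring-theoretic input of E3 that is not bookkeeping. -/
theorem wiebe_core {k : Type u} [Field k] {n : ℕ}
    (φ : Matrix (Fin n) (Fin n) (MvPowerSeries (Fin n) k))
    (hdet : φ.det ∉ Ideal.span (Set.range fun i => ∑ j, φ i j * MvPowerSeries.X j)) :
    IsArtinianRing
      (MvPowerSeries (Fin n) k ⧸ Ideal.span (Set.range fun i => ∑ j, φ i j * MvPowerSeries.X j)) := by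
  sorry

/-- **E3a4′ — Wiebe's criterion for a complete equicharacteristic local ring** (Simon–Strooker
Thm. 2.4 (iii) ⇒ (i), (a), (b) with `I = 0`, Cor. 2.7, in the case — sufficient for Taylor–Wiles, where
`C = R̄_Q/𝔪_{k[Δ]}R̄_Q = R_∅ ⊗ k` is a quotient of a power-series ring over `k` — that `C` is
`𝔪_C`-adically complete with coefficient field `k`; size M GIVEN E3a4: the substitution
`k[[X]] → C`, `Xᵢ ↦ uᵢ` exists (completeness) and is onto (residue field `k` + completeness); lift `W`
to `φ'`; `det φ' ∉ ker ⊇ (φ'·X)`, so E3a4 makes `k[[X]]/(φ'·X)` Artinian, its socle is `(det φ')` and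
lies in every strictly larger ideal (tree `TateGorensteinField`), forcing `ker = (φ'·X)`). Conclusions:
`C` is Artinian, `det W` generates its socle `(0 : 𝔪_C)`, and `C ≅ k[[X₁…Xₙ]]/(f₁…fₙ)` (the tree
predicate, as many relations as variables). The general Noetherian statement (no completeness, no
coefficient field) is Simon–Strooker Cor. 2.7 and is NOT needed here. -/
theorem wiebe_complete {k C : Type u} [Field k] [CommRing C] [IsNoetherianRing C] [IsLocalRing C]
    [IsAdicComplete (maximalIdeal C) C] [Algebra k C]
    (hk : Function.Surjective (⇑(IsLocalRing.residue C) ∘ ⇑(algebraMap k C)))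
    {n : ℕ} (u : Fin n → C) (hu : Ideal.span (Set.range u) = maximalIdeal C)
    (W : Matrix (Fin n) (Fin n) C) (hW : ∀ i, ∑ j, W i j * u j = 0) (hdet : W.det ≠ 0) :
    IsArtinianRing C ∧ (maximalIdeal C).annihilator = Ideal.span {W.det} ∧
      IsCompleteIntersectionOver k C := by
  sorry

/-- **E3a5 — weakly torsion-free ⇒ free over an Artinian local ring with principal socle**
(Brochard–Mézard, Manuscripta Math. 2011, Prop. 2.? as used in Brochard 2017, proof of Thm. 1.1,
for FINITE modules, where it is ten lines: take a minimal free cover `0 → K → Cᵈ → N → 0`,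
`K ⊆ 𝔪Cᵈ`; if `K ≠ 0` pick `0 ≠ v ∈ K` with `𝔪v = 0` (`K` is Artinian); `v = s • w` with some
`wᵢ ∉ 𝔪`; then `s • π(w) = 0`, so `π(w) ∈ 𝔪N`, so `w ∈ 𝔪Cᵈ + K ⊆ 𝔪Cᵈ`, contradiction; size M).
No "contains a field" hypothesis is needed for finite `N`. -/
theorem free_of_weaklyTorsionFree {C : Type u} [CommRing C] [IsArtinianRing C] [IsLocalRing C]
    (s : C) (hs : (maximalIdeal C).annihilator = Ideal.span {s})
    {N : Type v} [AddCommGroup N] [Module C N] [Module.Finite C N]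
    (hwtf : ∀ m : N, s • m = 0 → m ∈ (maximalIdeal C) • (⊤ : Submodule C N)) :
    Module.Free C N := by
  sorry

/-- **E3a — Brochard's theorem (de Smit's conjecture), free-input complete-equicharacteristic form**
(Brochard 2017, Thm. 1.1 (1), (2), (4), for `M` free over `A`, `B` complete and `A` with coefficient
field `k` — the Taylor–Wiles case `k[Δ_Q] → R̄_Q`, `M = H̄`; size S GIVEN E3a1–E3a5, following
Brochard 2023, proof of Thm. 22: `x` = image of a minimal generating system of `𝔪_A` (`n = edim A`
elements), `u` = a generating family of `𝔪_B` of length `n` (possible as `edim B ≤ n`), `x = W u`;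
E3a2′ + E3a1′ give `det W ∉ 𝔪_A B` and hence (a zero column otherwise) `edim B = edim A`; E3a4′ makes
`C = B/𝔪_A B` Artinian with socle `(det W̄)` and a complete intersection over `k`; E3a1 says
`N = M/𝔪_A M` is weakly torsion-free for `det W̄` (if `λ̄ ≠ 0` then `(det W̄) ⊆ (λ̄)`), so `N` is free
over `C` by E3a5; E3a2″ + E3a3 lift to `M` free over `B`). `hres`/`hk` (trivial residue extensions)
are what make Brochard's "relative complete intersection" the tree's `IsCompleteIntersectionOver k`.
The general statement (any Noetherian local `A → B`, `M` only `A`-flat) is Brochard's Thm. 1.1 and is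
not needed by E3c. -/
theorem brochard_deSmit {k : Type u} [Field k] {A : Type u} [CommRing A] [IsLocalRing A]
    [IsNoetherianRing A] [Algebra k A]
    (hk : Function.Surjective (⇑(IsLocalRing.residue A) ∘ ⇑(algebraMap k A)))
    [IsLocalRing B] [IsNoetherianRing B] [IsAdicComplete (maximalIdeal B) B]
    [Algebra k B] [Algebra A B] [IsScalarTower k A B] [IsLocalHom (algebraMap A B)]
    (hres : Function.Surjective (IsLocalRing.ResidueField.map (algebraMap A B)))
    (hedim : edim B ≤ edim A)
    {M : Type v} [AddCommGroup M] [Module B M] [Module A M] [IsScalarTower A B M]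
    [Module.Finite B M] [Nontrivial M] [Module.Free A M] :
    Module.Free B M ∧ edim B = edim A ∧
      IsArtinianRing (B ⧸ (maximalIdeal A).map (algebraMap A B)) ∧
      IsCompleteIntersectionOver k (B ⧸ (maximalIdeal A).map (algebraMap A B)) := by
  sorry

/-! ### E3b  Nakayama descents from `k = O/λ` to `O` (Brochard 2017, Lemma 10) -/

/-- **E3b1 — injectivity descends** (Brochard 2017, Lemma 10 (1) for a surjective algebra map onto an
`O`-free algebra; the tree's `Literature.RingTheory.CompleteIntersection.injective_of_residually_injective`
is the same argument but asks for an augmentation `π : T → O`, used only to see `ϖ ∈ 𝔪_R` — here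
replaced by `IsLocalHom (algebraMap O R)`; size S: `ker φ = ϖ · ker φ` by torsion-freeness of `T`,
then Nakayama over `R`). -/
theorem injective_of_injective_residue {O : Type u} [CommRing O] [IsDomain O]
    [IsDiscreteValuationRing O]
    {R : Type v} [CommRing R] [IsLocalRing R] [IsNoetherianRing R] [Algebra O R]
    [IsLocalHom (algebraMap O R)]
    {T : Type v} [CommRing T] [Algebra O T] [Module.IsTorsionFree O T]
    (φ : R →ₐ[O] T)
    (h : ∀ a, φ a ∈ (maximalIdeal O).map (algebraMap O T) →
      a ∈ (maximalIdeal O).map (algebraMap O R)) :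
    Function.Injective φ := by
  sorry

/-- **E3b2 — freeness descends** (Brochard 2017, Lemma 10 (2); size S: lift a basis of `M/𝔪_O M`
over `A/𝔪_O A` to `f : Aᴶ → M`; `f ⊗ k` bijective and `M` free over `O` ⇒ `f` bijective by
Lemma 10 (1), Mathlib Nakayama `Submodule.eq_bot_of_le_smul_of_le_jacobson_bot`-style). -/
theorem free_of_free_residue {O : Type u} [CommRing O] [IsLocalRing O] [IsNoetherianRing O]
    {A : Type v} [CommRing A] [Algebra O A] [Module.Finite O A]
    {M : Type v} [AddCommGroup M] [Module A M] [Module O M] [IsScalarTower O A M]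
    [Module.Finite O M] [Module.Free O M]
    (h : Module.Free (A ⧸ (maximalIdeal O).map (algebraMap O A))
      (M ⧸ (((maximalIdeal O).map (algebraMap O A)) • ⊤ : Submodule A M))) :
    Module.Free A M := by
  sorry

/-- **E3b3 — "complete intersection" descends** (Brochard 2017, Lemma 10 (3) with `A = O`; size M:
lift the presentation `k[[X]]/(f) ≅ T/𝔪_O T` to `ψ : O[[X]] → T` (needs `O` complete and `T`
finite, so that `Xᵢ ↦ tᵢ ∈ 𝔪_T` extends), lift the `fᵢ` into `ker ψ`; the induced map is bijective
modulo `𝔪_O`, hence bijective (`T` free over `O`, Nakayama twice)). -/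
theorem isCompleteIntersectionOver_of_residue {O : Type u} [CommRing O] [IsLocalRing O]
    [IsNoetherianRing O] [IsAdicComplete (maximalIdeal O) O]
    {T : Type v} [CommRing T] [IsLocalRing T] [Algebra O T] [IsLocalHom (algebraMap O T)]
    [Module.Finite O T] [Module.Free O T]
    (h : IsCompleteIntersectionOver
      (O ⧸ maximalIdeal O) (T ⧸ (maximalIdeal O).map (algebraMap O T))) :
    IsCompleteIntersectionOver O T := by
  sorry

/-! ### E3c  One Taylor–Wiles level ⇒ minimal `R = T` (Brochard 2017, Thm. 9 + Remark 11), abstractly -/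

/-- **E3c̄ — the statement modulo `λ`** (Brochard 2017, proof of Thm. 9, first paragraph; size S
GIVEN E3a): `A = k[Δ_Q]` (a local Artinian `k`-algebra with residue field `k` and `edim A = #Q`),
`Bring = R̄_Q = R_Q ⊗ k` (complete Noetherian local), `Tb = T̄_Q`, `Mb = H̄`. If `A → Bring` is local
with trivial residue extension and `edim Bring ≤ edim A` (G1), `Bring ↠ Tb`, and the nonzero finite
`Tb`-module `Mb` is free over `A` (G2), then `Mb` is free over `Bring`, `Bring → Tb` is bijective (a
kernel element would kill the free module `Mb`), and `Bring/𝔪_A Bring = R_∅ ⊗ k` is an Artinian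
complete intersection over `k`. Multiplicity one (`Mb` free over `Tb`) is thus an OUTPUT. -/
theorem oneLevel_residual {k : Type u} [Field k] {A : Type u} [CommRing A] [IsLocalRing A]
    [IsNoetherianRing A] [Algebra k A]
    (hk : Function.Surjective (⇑(IsLocalRing.residue A) ∘ ⇑(algebraMap k A)))
    {Bring : Type u} [CommRing Bring] [IsLocalRing Bring] [IsNoetherianRing Bring]
    [IsAdicComplete (maximalIdeal Bring) Bring]
    [Algebra k Bring] [Algebra A Bring] [IsScalarTower k A Bring] [IsLocalHom (algebraMap A Bring)]
    (hres : Function.Surjective (IsLocalRing.ResidueField.map (algebraMap A Bring)))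
    (hedim : edim Bring ≤ edim A)
    {Tb : Type u} [CommRing Tb] [Algebra Bring Tb]
    (hφ : Function.Surjective (algebraMap Bring Tb))
    {Mb : Type v} [AddCommGroup Mb] [Module Tb Mb] [Module Bring Mb] [Module A Mb]
    [IsScalarTower Bring Tb Mb] [IsScalarTower A Bring Mb]
    [Module.Finite Bring Mb] [Nontrivial Mb] [Module.Free A Mb] :
    Module.Free Bring Mb ∧ Function.Bijective (algebraMap Bring Tb) ∧
      IsArtinianRing (Bring ⧸ (maximalIdeal A).map (algebraMap A Bring)) ∧
      IsCompleteIntersectionOver k (Bring ⧸ (maximalIdeal A).map (algebraMap A Bring)) := by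
  sorry

/-- **E3c — the statement over `O`, at level `Q` and at minimal level** (Brochard 2017, Thm. 9
(1), (4) and Remark 11; size M GIVEN E3c̄ and E3b1–E3b3). Data: `O` a complete discrete valuation
ring; `Λ = O[Δ_Q]`, `R = R_Q`, `T = T_Q` local Noetherian `O`-algebras with `Λ → R → T`, `R → T`
surjective, `T` finite free over `O`; `H` a `T`-module, finite free over `O`, nonzero; `𝔞 ⊆ Λ` the
augmentation ideal. Hypotheses "mod `λ`": (G2) `H/λH` free over `Λ/λΛ`, (G1) `edim(R/λR) ≤ edim(Λ/λΛ)`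
(stated through E3c̄'s conclusion to keep this signature instance-light: we ASSUME the residual
conclusion `hbar` and descend). Conclusions: `R → T` bijective, `H` free over `T`, and — reading
`R_∅ := R/𝔞R`, `T_∅ := T/𝔞T` (their identification with the minimal-level rings is seat G3) —
`T/𝔞T` is a complete intersection over `O` provided it is `O`-free and residually c.i.
This is the E3 replacement of generation 2's `drs_criterionII_oneLevel` (E2c). -/
theorem oneLevel_integral {O : Type u} [CommRing O] [IsDomain O] [IsDiscreteValuationRing O]
    [IsAdicComplete (maximalIdeal O) O]
    {R : Type u} [CommRing R] [IsLocalRing R] [IsNoetherianRing R] [Algebra O R]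
    [IsLocalHom (algebraMap O R)]
    {T : Type u} [CommRing T] [IsLocalRing T] [Algebra O T] [IsLocalHom (algebraMap O T)]
    [Module.Finite O T] [Module.Free O T]
    (φ : R →ₐ[O] T) (hφ : Function.Surjective φ)
    -- residual injectivity of `φ` (output of E3c̄ (2) for `R̄ → T̄`):
    (hbar : ∀ a, φ a ∈ (maximalIdeal O).map (algebraMap O T) →
      a ∈ (maximalIdeal O).map (algebraMap O R))
    {H : Type u} [AddCommGroup H] [Module T H] [Module O H] [IsScalarTower O T H]
    [Module.Finite O H] [Module.Free O H]
    -- residual freeness of `H̄` over `T̄` (output of E3c̄ (1) transported along `R̄ ≅ T̄`):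
    (hHbar : Module.Free (T ⧸ (maximalIdeal O).map (algebraMap O T))
      (H ⧸ (((maximalIdeal O).map (algebraMap O T)) • ⊤ : Submodule T H)))
    (𝔟 : Ideal T) -- `= 𝔞T`, the image of the augmentation ideal of `O[Δ_Q]`
    [IsLocalRing (T ⧸ 𝔟)] [Module.Free O (T ⧸ 𝔟)] [IsLocalHom (algebraMap O (T ⧸ 𝔟))]
    (hci : IsCompleteIntersectionOver
      (O ⧸ maximalIdeal O) ((T ⧸ 𝔟) ⧸ (maximalIdeal O).map (algebraMap O (T ⧸ 𝔟)))) :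
    Function.Bijective φ ∧ Module.Free T H ∧
      IsCompleteIntersectionOver O (T ⧸ 𝔟) := by
  sorry

/-! ### E3d  The base case of the level-raising induction needs "c.i. ⇒ numerical equality" -/

open Literature.RingTheory.CompleteIntersection in
/-- **E3d — complete intersections satisfy the numerical equality** (de Smit–Rubin–Schoof 1997,
Criterion I, direction "`φ` an isomorphism of complete intersections ⇒ equality", via their
Cor. 2.3 `Fit_T(I_T) = Ann_T(I_T)` = Prop. 2.1 (i) over `O` — in the tree only over a FIELD
(`TateGorensteinField.lean`); this is the backward half of the tree's named fact
`numericalCriterion_eq_iff` with `R = T`, `φ = id`; size M). It is the BASE CASE `Σ = ∅` of the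
Wiles/Ribet level-raising induction of generation 2 (F_BΣ): the inequality at level `Σ` is fed by
equality at `∅`, which comes from `T_∅` c.i. (E3c), not from `R_∅ ≅ T_∅` alone. -/
theorem length_cotangent_eq_length_congruence_of_ci {O : Type u} [CommRing O] [IsDomain O]
    [IsDiscreteValuationRing O] [IsAdicComplete (maximalIdeal O) O]
    {T : Type u} [CommRing T] [IsLocalRing T] [Algebra O T] [Module.Finite O T] [Module.Free O T]
    (hT : IsCompleteIntersectionOver O T) (π : T →ₐ[O] O) (hη : congruenceIdeal π ≠ ⊥) :
    Module.length O (CotangentModule π) = Module.length O (CongruenceModule π) := by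
  sorry

/-! ### Sanity: the vocabulary is not vacuous -/

/-- The empty family is independent (degenerate-witness check of `IsIndependent`). -/
theorem isIndependent_empty (x : Fin 0 → B) (M : Type v) [AddCommGroup M] [Module B M] :
    IsIndependent x M := by
  intro m _ i
  exact Fin.elim0 i

/-- `edim` of a field is `0` (degenerate-witness check of `edim`). -/
theorem edim_field (K : Type u) [Field K] : edim K = 0 := by
  unfold edim
  have h : maximalIdeal K = ⊥ := maximalIdeal_eq_bot
  haveI : Subsingleton (CotangentSpace K) := by
    refine ⟨fun a b => ?_⟩
    obtain ⟨a, rfl⟩ := Ideal.toCotangent_surjective _ a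
    obtain ⟨b, rfl⟩ := Ideal.toCotangent_surjective _ b
    have ha : (a : K) = 0 := by simpa [h] using a.2
    have hb : (b : K) = 0 := by simpa [h] using b.2
    congr 1
    exact Subtype.ext (ha.trans hb.symm)
  exact Module.finrank_zero_of_subsingleton

end Summit.ABC.ABC.Cruxes.FreyModularity.StubIdeas2g3
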